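import Literature.AnabelianGeometry.AbsoluteAnabelian.AbsTopIII.UnitGroupCompactness
import Literature.AnabelianGeometry.AbsoluteAnabelian.AbsTopIII.EquivariantSignRigidity
import HarnessLib

/-!
# [AbsTopIII] Prop 3.3 (ii) `TCG` / [IUTchII] Rmk 1.11.1 (i)(b) at the model: the
# `Gal(k̄/k)`-equivariant automorphisms of `𝒪_k̄^×` are exactly the `Ẑ^×`-powers

Proof-only companion (theorems only, no new definitions) in the lane of `MonoidKummerMaps.lean`
(seat abc-iut-L4-t2; S. Mochizuki, *Topics in Absolute Anabelian Geometry III*, Prop. 3.3 (ii)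
p. 74: for `T = TCG` the map `Isom((Π ↷ M),(Π* ↷ M*)) → Isom(Π,Π*) × Isom(μ_Ẑ(M), μ_Ẑ(M*))` "is a
bijection"; *Inter-universal Teichmüller Theory II*, Rmk. 1.11.1 (i)(b) p. 50: the automorphisms of
`G ↷ 𝒪^×(G)` over the identity of `G` are "the [`G`-linear] automorphisms … determined by the natural
action of `Ẑ^×`"; kurims manuscripts, lit keys `paper:url-5493eb38cbb7`, `paper:url-5036b4059555`).

An element of `Ẑ = lim ℤ/n` is a COMPATIBLE EXPONENT SYSTEM `a : ℕ → ℕ`, `a n ≡ a m (mod m)` for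
`m ∣ n` (`m, n ≥ 1`); it is a unit iff every `a n` is prime to `n`.  No definition of `Ẑ` or of its action is
introduced (the tree's `zhatPow` datum of `GaloisPairRigidity.lean` is an interface parameter); the
statements below are its content at the model data `(k, k̄)` of [AbsTopIII] §3 (`MLFClosure`), with
`𝒪_k̄^× = unitSubmonoid k k̄`:

* `MLFClosure.exists_equivariant_unitHom_of_compatible` — EXISTENCE: every compatible exponent system
  `a` is realised by a `Gal(k̄/k)`-equivariant multiplicative self-map `β_a` of `𝒪_k̄^×` with
  `β_a ζ = ζ^{a m}` on `μ_m` and `β_a x ∈ x^{a n} · (k⟮x⟯^×)^n` for all `n` (the value `x^a`;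
  construction: `UnitGroupCompactness.exists_unit_compatible_pow` + uniqueness from
  `⋂_n (k'^×)^n = 1`, abc-iut-L6-t21's `KummerFaithfulLocalFieldProofs`);
* the companion file `EquivariantUnitExponents.lean` proves the CONVERSE (every equivariant
  automorphism acts on the roots of unity through a compatible unit system), UNIQUENESS (it is
  determined by that action), and that for a UNIT system `β_a` is an automorphism — together: the
  `Gal(k̄/k)`-equivariant automorphisms of `𝒪_k̄^×` are exactly the `Ẑ^×`-powers, the `Ẑ^×`-torsor
  half of Prop. 3.3 (ii) for `TCG`.  The EXISTENCE of an isomorphism of pairs over a given `Π ⥲ Π*`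
  (local class field theory) is not addressed.  Companion of `EquivariantSignRigidity.lean` (`TLG`:
  `k̄^×`, where only `±1` survive).

HONEST FRAMING: OUR kernel check of classical statements quoted by refereed papers; nothing here
bears on [IUTchIII] Cor. 3.12.
-/

noncomputable section

namespace Literature.AnabelianGeometry.AbsoluteAnabelian

open _root_.ValuativeRel
open scoped IntermediateField

universe u

variable (C : MLFClosure.{u})

/-! ### Small facts about `𝒪_k̄^× = unitSubmonoid k k̄` -/

/-- Elements of `𝒪_k̄^×` are non-zero. [cite: MochizukiAbsTopIII2015, Definition 3.1 (i) p.66] -/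
theorem MLFClosure.ne_zero_of_mem_unitSubmonoid {x : C.K} (hx : x ∈ unitSubmonoid C.k C.K) : x ≠ 0 := by
  obtain ⟨-, y, -, hxy⟩ := hx
  exact left_ne_zero_of_mul_eq_one hxy

/-- Roots of unity of `k̄` lie in `𝒪_k̄^×`. [cite: MochizukiAbsTopIII2015, Definition 3.1 (i) p.66] -/
theorem MLFClosure.rootOfUnity_mem_unitSubmonoid {ζ : C.K} {n : ℕ} (hn : 0 < n) (hζ : ζ ^ n = 1) :
    ζ ∈ unitSubmonoid C.k C.K := by
  have hζint : IsIntegral 𝒪[C.k] ζ := IsIntegral.of_pow hn (by rw [hζ]; exact isIntegral_one)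
  refine ⟨(mem_integralClosure_iff _ _).mpr hζint, ζ ^ (n - 1),
    (mem_integralClosure_iff _ _).mpr (hζint.pow _), ?_⟩
  rw [← pow_succ', Nat.sub_add_cancel hn, hζ]

/-- `𝒪_k̄^×` is closed under extraction of roots (`k̄` is algebraically closed; roots of units are
units). [cite: MochizukiAbsTopIII2015, Definition 3.1 (i) p.66] -/
theorem MLFClosure.exists_unit_nthRoot {x : C.K} (hx : x ∈ unitSubmonoid C.k C.K) {n : ℕ} (hn : 0 < n) :
    ∃ y ∈ unitSubmonoid C.k C.K, y ^ n = x := by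
  haveI : IsAlgClosed C.K := IsAlgClosure.isAlgClosed C.k
  obtain ⟨hxi, x', hx'i, hxx'⟩ := hx
  have hx0 : x ≠ 0 := left_ne_zero_of_mul_eq_one hxx'
  obtain ⟨r, hr⟩ := IsAlgClosed.exists_pow_nat_eq x hn
  have hr0 : r ≠ 0 := by
    rintro rfl; rw [zero_pow hn.ne'] at hr; exact hx0 hr.symm
  have hrint : r ∈ integersClosure C.k C.K := by
    rw [integersClosure, mem_integralClosure_iff]
    exact IsIntegral.of_pow hn (by rw [hr]; exact (mem_integralClosure_iff _ _).mp hxi)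
  have hrinv : r⁻¹ ∈ integersClosure C.k C.K := by
    rw [integersClosure, mem_integralClosure_iff]
    refine IsIntegral.of_pow hn ?_
    rw [inv_pow, hr, ← eq_inv_of_mul_eq_one_right hxx']
    exact (mem_integralClosure_iff _ _).mp hx'i
  exact ⟨r, ⟨hrint, r⁻¹, hrinv, mul_inv_cancel₀ hr0⟩, hr⟩

/-- Powers of a root of unity only depend on the exponent modulo the order.
[cite: MochizukiAbsTopIII2015, Proposition 3.3 (ii) p.74] -/
theorem MLFClosure.pow_eq_pow_of_modEq {x : C.K} {m u v : ℕ} (hx : x ^ m = 1) (h : u ≡ v [MOD m]) :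
    x ^ u = x ^ v := by
  rw [← Nat.mod_add_div u m, ← Nat.mod_add_div v m, pow_add, pow_add, pow_mul, pow_mul, hx, one_pow,
    one_pow, h]

/-- **The uniqueness principle** at a finite level `k'` (abc-iut-L6-t21's `⋂_n (k'^×)^n = {1}`): two
non-zero elements of `k'` that differ by an `n`-th power of `k'` for every `n ≥ 1` are equal.
[cite: MochizukiAbsTopIII2015, Remark 1.5.4 (i) p.33] -/
theorem MLFClosure.eq_of_forall_exists_pow_mul (k' : IntermediateField C.k C.K) [FiniteDimensional C.k k']
    {Y₁ Y₂ : C.K} (h₁ : Y₁ ∈ k') (h₂ : Y₂ ∈ k') (h₁0 : Y₁ ≠ 0) (h₂0 : Y₂ ≠ 0)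
    (h : ∀ n : ℕ, 0 < n → ∃ w ∈ k', Y₁ = Y₂ * w ^ n) : Y₁ = Y₂ := by
  have hz : Y₁ / Y₂ = 1 := by
    refine MLFClosure.eq_one_of_forall_pos_exists_pow_eq C k' (div_mem h₁ h₂) (div_ne_zero h₁0 h₂0)
      fun n hn => ?_
    obtain ⟨w, hw, hY⟩ := h n hn
    exact ⟨w, hw, by rw [hY, mul_div_cancel_left₀ _ h₂0]⟩
  rwa [div_eq_one_iff_eq h₂0] at hz

/-- The Galois group maps `k⟮x⟯` onto `k⟮σ x⟯`. [cite: MochizukiAbsTopIII2015, Definition 3.1 (i) p.66] -/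
theorem MLFClosure.map_mem_adjoin_simple (σ : C.K ≃ₐ[C.k] C.K) {x w : C.K} (hw : w ∈ C.k⟮x⟯) :
    σ w ∈ C.k⟮σ x⟯ := by
  have h : σ w ∈ (C.k⟮x⟯).map (σ : C.K →ₐ[C.k] C.K) := ⟨w, hw, rfl⟩
  rw [IntermediateField.adjoin_map, Set.image_singleton] at h
  exact h

/-! ### Existence: the compatible exponent system `a` acts on `𝒪_k̄^×` -/

/-- **Compatible powers of a unit at a finite level** (the form of
`UnitGroupCompactness.exists_unit_compatible_pow` with the compatibility hypothesis restricted to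
POSITIVE indices, which is what an element of `Ẑ = lim_{n ≥ 1} ℤ/n` provides): for a finite level `k'`,
a unit `x ∈ 𝒪_k̄^× ∩ k'` and `a : ℕ → ℕ` with `a n ≡ a m (mod m)` for `m ∣ n`, `m, n ≥ 1`, there is
`y ∈ 𝒪_k̄^× ∩ k'` with `y = x^{a n} · w^n`, `w ∈ k'^×`, for every `n ≥ 1`.
[cite: MochizukiAbsTopIII2015, Proposition 3.3 (ii) p.74] -/
theorem MLFClosure.exists_unit_compatible_pow' (k' : IntermediateField C.k C.K) [FiniteDimensional C.k k']
    (x : k') (hx : (x : C.K) ∈ unitSubmonoid C.k C.K) (a : ℕ → ℕ)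
    (ha : ∀ m n : ℕ, 0 < m → 0 < n → m ∣ n → a n ≡ a m [MOD m]) :
    ∃ y : k', (y : C.K) ∈ unitSubmonoid C.k C.K ∧
      ∀ n : ℕ, 0 < n → ∃ w : k', w ≠ 0 ∧ y = x ^ a n * w ^ n := by
  classical
  letI := Literature.NumberTheory.GaloisRepresentations.FiniteExtension.normedField C.k k'
  letI := Literature.NumberTheory.GaloisRepresentations.FiniteExtension.valuativeRel C.k k'
  haveI : IsNonarchimedeanLocalField k' :=
    Literature.NumberTheory.GaloisRepresentations.FiniteExtension.isNonarchimedeanLocalField C.k k'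
  have hxv : valuation k' x = 1 := (C.mem_unitSubmonoid_iff_valuation_eq_one k' x).mp hx
  have hx0 : x ≠ 0 := fun h => by rw [h, map_zero] at hxv; exact zero_ne_one hxv
  obtain ⟨y, hyv, hy⟩ := exists_mem_iInter_pow_cosets k' hxv (fun j => (j + 1).factorial)
    (fun j => (a (j + 1).factorial : ℤ))
    (fun j => Nat.factorial_dvd_factorial (Nat.le_succ _))
    (fun j => (Nat.modEq_iff_dvd.mp (ha _ _ (Nat.factorial_pos _) (Nat.factorial_pos _)
      (Nat.factorial_dvd_factorial (Nat.le_succ _))).symm))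
  refine ⟨y, (C.mem_unitSubmonoid_iff_valuation_eq_one k' y).mpr hyv, fun n hn => ?_⟩
  obtain ⟨w, hwv, hyw⟩ := hy (n - 1)
  have hN : (n - 1 + 1).factorial = n * (n - 1).factorial := by
    rw [Nat.sub_add_cancel hn]
    exact (Nat.mul_factorial_pred hn.ne').symm
  have hw0 : w ≠ 0 := fun h => by rw [h, map_zero] at hwv; exact zero_ne_one hwv
  have hmod : a ((n - 1 + 1).factorial) ≡ a n [MOD n] :=
    ha n _ hn (Nat.factorial_pos _) (by rw [Nat.sub_add_cancel hn]; exact Nat.dvd_factorial hn le_rfl)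
  obtain ⟨t, ht⟩ := (Nat.modEq_iff_dvd.mp hmod.symm)
  refine ⟨x ^ t * w ^ (n - 1).factorial, mul_ne_zero (zpow_ne_zero _ hx0) (pow_ne_zero _ hw0), ?_⟩
  rw [hyw, hN, mul_pow, ← pow_mul, mul_comm ((n - 1).factorial) n, ← mul_assoc]
  congr 1
  simp only [← zpow_natCast]
  rw [← zpow_mul, ← zpow_add₀ hx0]
  congr 1
  rw [hN] at ht
  linarith

/-- Pointwise form at the level `k⟮x⟯`: for `x ∈ 𝒪_k̄^×` and a compatible exponent system `a` there is
`Y ∈ 𝒪_k̄^× ∩ k⟮x⟯` with `Y ∈ x^{a n} · (k⟮x⟯^×)^n` for all `n ≥ 1`.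
[cite: MochizukiAbsTopIII2015, Proposition 3.3 (ii) p.74] -/
theorem MLFClosure.exists_unit_compatible_pow_adjoin (a : ℕ → ℕ)
    (ha : ∀ m n : ℕ, 0 < m → 0 < n → m ∣ n → a n ≡ a m [MOD m]) {x : C.K} (hx : x ∈ unitSubmonoid C.k C.K) :
    ∃ Y : C.K, Y ∈ unitSubmonoid C.k C.K ∧ Y ∈ C.k⟮x⟯ ∧
      ∀ n : ℕ, 0 < n → ∃ w ∈ C.k⟮x⟯, w ≠ 0 ∧ Y = x ^ a n * w ^ n := by
  haveI : FiniteDimensional C.k C.k⟮x⟯ :=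
    IntermediateField.adjoin.finiteDimensional (Algebra.IsIntegral.isIntegral x)
  obtain ⟨y, hyM, hy⟩ := C.exists_unit_compatible_pow' C.k⟮x⟯
    ⟨x, IntermediateField.mem_adjoin_simple_self C.k x⟩ hx a ha
  refine ⟨y, hyM, y.2, fun n hn => ?_⟩
  obtain ⟨w, hw0, hyw⟩ := hy n hn
  refine ⟨w, w.2, fun h => hw0 (Subtype.ext h), ?_⟩
  have := congrArg Subtype.val hyw
  simpa using this

/-- **Existence.**  Every compatible exponent system `a` (an element of `Ẑ`) is realised on `𝒪_k̄^×` by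
a `Gal(k̄/k)`-equivariant multiplicative map `β` ("`x ↦ x^a`"): `β x ∈ x^{a n} · (k⟮x⟯^×)^n` for all
`n ≥ 1`, and `β ζ = ζ^{a m}` for every `m`-th root of unity `ζ`.  Multiplicativity, equivariance and
the value on roots of unity each follow from the characterisation by the uniqueness principle at a
finite level (`k⟮x, y⟯`, `k⟮σ x⟯`, `k⟮ζ⟯`). [cite: MochizukiAbsTopIII2015, Proposition 3.3 (ii) p.74] -/
theorem MLFClosure.exists_equivariant_unitHom_of_compatible (a : ℕ → ℕ)
    (ha : ∀ m n : ℕ, 0 < m → 0 < n → m ∣ n → a n ≡ a m [MOD m]) :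
    ∃ β : unitSubmonoid C.k C.K →* unitSubmonoid C.k C.K,
      (∀ (σ : C.K ≃ₐ[C.k] C.K) (x y : unitSubmonoid C.k C.K), (y : C.K) = σ x →
        ((β y : unitSubmonoid C.k C.K) : C.K) = σ ((β x : unitSubmonoid C.k C.K) : C.K)) ∧
      (∀ (x : unitSubmonoid C.k C.K) (m : ℕ), 0 < m → (x : C.K) ^ m = 1 →
        ((β x : unitSubmonoid C.k C.K) : C.K) = (x : C.K) ^ a m) ∧
      (∀ (x : unitSubmonoid C.k C.K) (n : ℕ), 0 < n → ∃ w ∈ C.k⟮(x : C.K)⟯, w ≠ 0 ∧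
        ((β x : unitSubmonoid C.k C.K) : C.K) = (x : C.K) ^ a n * w ^ n) := by
  classical
  choose F hFM hFk hF using fun x : unitSubmonoid C.k C.K =>
    MLFClosure.exists_unit_compatible_pow_adjoin C a ha x.2
  have hF0 : ∀ x, F x ≠ 0 := fun x => MLFClosure.ne_zero_of_mem_unitSubmonoid C (hFM x)
  have hne : ∀ x : unitSubmonoid C.k C.K, (x : C.K) ≠ 0 := fun x =>
    MLFClosure.ne_zero_of_mem_unitSubmonoid C x.2
  have hint : ∀ z : C.K, IsIntegral C.k z := fun z => Algebra.IsIntegral.isIntegral z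
  -- multiplicativity
  have hmul : ∀ x y : unitSubmonoid C.k C.K, F (x * y) = F x * F y := by
    intro x y
    haveI := IntermediateField.finiteDimensional_adjoin_pair (hint (x : C.K)) (hint (y : C.K))
    have hxle : C.k⟮(x : C.K)⟯ ≤ C.k⟮(x : C.K), (y : C.K)⟯ :=
      IntermediateField.adjoin.mono _ _ _ (by simp)
    have hyle : C.k⟮(y : C.K)⟯ ≤ C.k⟮(x : C.K), (y : C.K)⟯ :=
      IntermediateField.adjoin.mono _ _ _ (by simp)
    have hxyle : C.k⟮((x * y : unitSubmonoid C.k C.K) : C.K)⟯ ≤ C.k⟮(x : C.K), (y : C.K)⟯ := by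
      rw [IntermediateField.adjoin_simple_le_iff, Submonoid.coe_mul]
      exact mul_mem (IntermediateField.subset_adjoin _ _ (by simp))
        (IntermediateField.subset_adjoin _ _ (by simp))
    refine MLFClosure.eq_of_forall_exists_pow_mul C C.k⟮(x : C.K), (y : C.K)⟯ (hxyle (hFk _))
      (mul_mem (hxle (hFk x)) (hyle (hFk y))) (hF0 _) (mul_ne_zero (hF0 x) (hF0 y)) fun n hn => ?_
    obtain ⟨w₁, hw₁, hw₁0, h₁⟩ := hF x n hn
    obtain ⟨w₂, hw₂, hw₂0, h₂⟩ := hF y n hn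
    obtain ⟨w₃, hw₃, hw₃0, h₃⟩ := hF (x * y) n hn
    refine ⟨w₃ / (w₁ * w₂), div_mem (hxyle hw₃) (mul_mem (hxle hw₁) (hyle hw₂)), ?_⟩
    rw [h₃, h₁, h₂, Submonoid.coe_mul, div_pow, mul_pow, mul_pow]
    field_simp
  -- the monoid hom
  let β : unitSubmonoid C.k C.K →* unitSubmonoid C.k C.K :=
    { toFun := fun x => ⟨F x, hFM x⟩
      map_one' := by
        apply Subtype.ext
        change F 1 = 1
        haveI : FiniteDimensional C.k C.k⟮((1 : unitSubmonoid C.k C.K) : C.K)⟯ :=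
          IntermediateField.adjoin.finiteDimensional (hint _)
        refine MLFClosure.eq_of_forall_exists_pow_mul C C.k⟮((1 : unitSubmonoid C.k C.K) : C.K)⟯
          (hFk 1) (one_mem _) (hF0 1) one_ne_zero fun n hn => ?_
        obtain ⟨w, hw, -, h⟩ := hF 1 n hn
        exact ⟨w, hw, by rw [h, OneMemClass.coe_one, one_pow]⟩
      map_mul' := fun x y => Subtype.ext (hmul x y) }
  have hβ : ∀ x, ((β x : unitSubmonoid C.k C.K) : C.K) = F x := fun x => rfl
  refine ⟨β, ?_, ?_, ?_⟩
  · -- equivariance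
    intro σ x y hyx
    rw [hβ, hβ]
    haveI : FiniteDimensional C.k C.k⟮(y : C.K)⟯ := IntermediateField.adjoin.finiteDimensional (hint _)
    have hσFk : σ (F x) ∈ C.k⟮(y : C.K)⟯ := by
      rw [hyx]; exact MLFClosure.map_mem_adjoin_simple C σ (hFk x)
    have hσF0 : σ (F x) ≠ 0 := (map_ne_zero_iff σ σ.injective).mpr (hF0 x)
    refine (MLFClosure.eq_of_forall_exists_pow_mul C C.k⟮(y : C.K)⟯ hσFk (hFk y) hσF0 (hF0 y)
      fun n hn => ?_).symm
    obtain ⟨w, hw, hw0, h⟩ := hF x n hn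
    obtain ⟨w', hw', hw'0, h'⟩ := hF y n hn
    refine ⟨σ w / w', div_mem (by rw [hyx]; exact MLFClosure.map_mem_adjoin_simple C σ hw) hw', ?_⟩
    rw [h, h', map_mul, map_pow, map_pow, ← hyx, div_pow]
    field_simp
  · -- roots of unity
    intro x m hm hxm
    rw [hβ]
    haveI : FiniteDimensional C.k C.k⟮(x : C.K)⟯ := IntermediateField.adjoin.finiteDimensional (hint _)
    refine MLFClosure.eq_of_forall_exists_pow_mul C C.k⟮(x : C.K)⟯ (hFk x)
      (pow_mem (IntermediateField.mem_adjoin_simple_self C.k (x : C.K)) _) (hF0 x)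
      (pow_ne_zero _ (hne x)) fun n hn => ?_
    obtain ⟨w, hw, -, h⟩ := hF x (n * m) (Nat.mul_pos hn hm)
    refine ⟨w ^ m, pow_mem hw _, ?_⟩
    rw [h, C.pow_eq_pow_of_modEq hxm (ha m (n * m) hm (Nat.mul_pos hn hm) (dvd_mul_left m n)),
      ← pow_mul, mul_comm n m]
  · intro x n hn
    rw [hβ]
    exact hF x n hn

end Literature.AnabelianGeometry.AbsoluteAnabelian

end
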